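import Summits.Ventures.FusionMHD.Bench.SolovevPCFNstxMercierEdgeIntegrals2
import HarnessLib

/-!
# F1 / MERCIER at the NSTX-like PCF edge — KERNEL BRIDGE 3/3: the GGJ input record of the TYPED equilibrium's edge surface
# equals the certificate's record; the Mercier criterion (Jardin (8.134)) on the tree's own functionals, end to end
(venture LADDER-GRIDFUSION, rung F1.MERCIER-profile; cell `gridfusion`, seat `gridfusion-sos-6` (g3), 2026-08-27; see
`…NstxMercierEdgeIntegrals1` for the purpose of the series.)

§4 constants: `κ₀·4√(|d₃|α) = c`, `√(q₀²/F²)·R_a³·8√(|d₃|α) = 1`, `C_s = 1`. §5 `lcEdgeData g := lcGGJData κ₀ g R_a q₀(g)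
(ε/R_a) g (ε/R_a)` field by field (`V′ = Vp`, `V″ = Vratio·Vp`, `Φ′ = gK₄/(4√(|d₃|α))`, `Φ″ = g·phihat·Vp`, `I′ = Vp/(2π)`,
`p′ = −1`, the four averages) and **`lcEdgeData_eq_edgeData : lcEdgeData g = edgeData g (Vp/(2π))`** (all thirteen fields).
§6 **`mercierCriterion_lcEdgeData_of_le : ∀ g ≥ 1/4, (lcEdgeData g).MercierCriterion`**, label independence
(`relabel h₁ h₂`, `h₁ ≠ 0`; model-5's force balance p485756 + lit-3's covariance p479625), and `mercierAxis_and_lcEdge_of_le`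
(`F ≥ F_M⁺ = 1.11855148457759885406`: near-axis Mercier p472230 AND the edge criterion on the typed objects).
Not here: interior surfaces `0 < r < a`; the VALIDATED threshold picture (cert/F/mercier-dm-validated.md).
HONEST FRAMING (LADDER-GRIDFUSION three columns, never merged): CERTIFIED = kernel identities/inequalities about the MODEL's
edge surface (ideal MHD, axisymmetric, Solov'ev profiles `μ₀p′ = −1`, `FF′ = 0`, analytic fixed-boundary PCF equilibrium
[cite: PatakiCerfonFreidberg2013, §6.1], free constant `F = RB_φ` a parameter); VALIDATED cross-checks live in
`pub/gridfusion/cert/F/mercier-dm-validated.md`; Mercier/GGJ is a NECESSARY (local interchange) criterion; nothing here says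
any plasma or device is stable. No `native_decide`; no `decide` in this file (the enclosures are the imported Data files').
-/

noncomputable section

open Real MeasureTheory Set intervalIntegral
open Literature.Analysis.ValidatedNumerics Literature.Analysis.ValidatedNumerics.PolyMP
open Literature.Analysis.ValidatedNumerics.ExpPoly (Poly)
open Literature.MathematicalPhysics.MHD Literature.MathematicalPhysics.MHD.Solovev
open Summit.Ventures.FusionMHD.Models.SolovevPCF

namespace Summit.Ventures.FusionMHD.Bench.SolovevPCFNstx.MercierEdge

open Summit.Ventures.FusionMHD.Bench.SolovevPCFIter.MercierEdge (theta theta_arg_sq theta_arg_lt_one cos_theta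
  sin_sq_theta theta_zero theta_one continuous_theta hasDerivAt_theta integral_zero_pi_eq_theta integral_zero_two_pi_eq
  integral_zero_two_pi_eq_theta eval_const_two sqrt_two_sub_pos uIcc01)

/-! ## §4 The constants: `κ₀`, `q₀/F`, `C_s` of the instance against the certificate's `√(|d₃|α)` -/

/-- `κ₀·4√(|d₃|α) = c` (`κ₀² = E = α/|d₃|`, `c = 4α`). [folklore] -/
theorem kappa0_mul_sqrt : NstxLike.kappa0 * (4 * Real.sqrt d3alpha) = (1691292800 / 4215904879 : ℝ) := by
  have hk := NstxLike.kappa0_pos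
  have hs : 0 < Real.sqrt d3alpha := Real.sqrt_pos.2 (by unfold d3alpha; norm_num)
  have hsq : (NstxLike.kappa0 * (4 * Real.sqrt d3alpha)) ^ 2 = (1691292800 / 4215904879 : ℝ) ^ 2 := by
    rw [mul_pow, mul_pow, NstxLike.kappa0_sq, Real.sq_sqrt (by unfold d3alpha; norm_num)]
    unfold NstxLike.elongSq d3alpha; norm_num
  exact (pow_left_inj₀ (by positivity) (by norm_num) two_ne_zero).1 hsq

/-- `κ₀ = c/(4√(|d₃|α))`. [folklore] -/
theorem kappa0_eq_div : NstxLike.kappa0 = (1691292800 / 4215904879 : ℝ) / (4 * Real.sqrt d3alpha) := by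
  have hs : 0 < Real.sqrt d3alpha := Real.sqrt_pos.2 (by unfold d3alpha; norm_num)
  rw [eq_div_iff (by positivity), kappa0_mul_sqrt]

/-- `√(q₀²/F²)·R_a³·8√(|d₃|α) = 1` (`(q₀/F)² = 1/(64α|d₃|u₀³)`, `R_a² = u₀`). [folklore] -/
theorem sqrt_q0Sq_mul : Real.sqrt NstxLike.q0SqOverFSq * NstxLike.Ra ^ 3 * (8 * Real.sqrt d3alpha) = 1 := by
  have hs : 0 < Real.sqrt d3alpha := Real.sqrt_pos.2 (by unfold d3alpha; norm_num)
  have hq : 0 < Real.sqrt NstxLike.q0SqOverFSq := Real.sqrt_pos.2 (by unfold NstxLike.q0SqOverFSq; norm_num)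
  have hR := NstxLike.Ra_pos
  have hsq : (Real.sqrt NstxLike.q0SqOverFSq * NstxLike.Ra ^ 3 * (8 * Real.sqrt d3alpha)) ^ 2 = 1 ^ 2 := by
    rw [mul_pow, mul_pow, mul_pow, Real.sq_sqrt (by unfold NstxLike.q0SqOverFSq; norm_num),
      Real.sq_sqrt (by unfold d3alpha; norm_num), show (NstxLike.Ra ^ 3) ^ 2 = (NstxLike.Ra ^ 2) ^ 3 by ring,
      NstxLike.Ra_sq]
    unfold NstxLike.q0SqOverFSq d3alpha; norm_num
  exact (pow_left_inj₀ (by positivity) (by norm_num) two_ne_zero).1 hsq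

/-- `√(q₀²/F²) = 1/(8√(|d₃|α)R_a³)`. [folklore] -/
theorem sqrt_q0Sq_eq : Real.sqrt NstxLike.q0SqOverFSq = 1 / (8 * Real.sqrt d3alpha * NstxLike.Ra ^ 3) := by
  have hs : 0 < Real.sqrt d3alpha := Real.sqrt_pos.2 (by unfold d3alpha; norm_num)
  have hR := NstxLike.Ra_pos
  rw [eq_div_iff (by positivity), ← sqrt_q0Sq_mul]
  ring

/-- **`C_s = 1` for the instance** (`Δ*Ψ = R²`: `μ₀p′ = −1`, `FF′ = 0`), from the Lee–Cerfon source constant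
`C_s = F(κ₀ + 1/κ₀)/(R_a³q₀(F))`. [cite: PatakiCerfonFreidberg2013, §6.1] -/
theorem csLC_edge {g : ℝ} (hg : 0 < g) : csLC NstxLike.kappa0 g NstxLike.Ra (NstxLike.q0 g) = 1 := by
  have hk := NstxLike.kappa0_pos
  have hs : 0 < Real.sqrt d3alpha := Real.sqrt_pos.2 (by unfold d3alpha; norm_num)
  have hR := NstxLike.Ra_pos
  have hD : Real.sqrt d3alpha ^ 2 = d3alpha := Real.sq_sqrt (by unfold d3alpha; norm_num)
  unfold csLC
  rw [NstxLike.q0_eq g hg.le, sqrt_q0Sq_eq, kappa0_eq_div]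
  rw [div_eq_one_iff_eq (by positivity)]
  field_simp
  rw [hD]
  unfold d3alpha
  ring

/-! ## §5 The data of the typed equilibrium's edge surface IS the certificate's edge data -/

/-- **model-5's GGJ input record of the EDGE surface of the NSTX-like instance:** the thirteen Jardin (8.134) inputs
as the tree's functionals (`volumeDerivE`, `toroidalFluxDerivJ`, `toroidalCurrentJ`, `surfaceAverageE` of
`Literature/…/FluxSurfaceAverage`) of `Ψ = psiLC κ₀ g R_a q₀(g) (ε/R_a)` (`= NstxLike.psi`, `NstxLike.psi_eq_psiLC`) on the
printed loop `lcLoop R_a κ₀ (ε/R_a)` of the plasma edge `Ψ = 0`, with the free constant `F ≡ g`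
(`Solovev.lcGGJData`, p481986). [cite: Jardin2010, §8.5 eq. (8.134)] -/
def lcEdgeData (g : ℝ) : Literature.MathematicalPhysics.MHD.Mercier.FluxForm.SurfaceData :=
  lcGGJData NstxLike.kappa0 g NstxLike.Ra (NstxLike.q0 g) (NstxLike.ε / NstxLike.Ra) g (NstxLike.ε / NstxLike.Ra)

section fields

variable {g : ℝ} (hg : 0 < g)
include hg

/-- `V′` of the typed edge surface `=` the certificate's `Vp = πK₁/(2√(|d₃|α))`. [cite: Jardin2010, §5.3 eq. (5.29)] -/
theorem lcEdgeData_V' : (lcEdgeData g).V' = Vp := by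
  unfold lcEdgeData Vp
  rw [lcGGJData_V' NstxLike.Ra_pos NstxLike.kappa0_pos hg (NstxLike.q0_pos hg) NstxLike.edge_minorRadius.1
    NstxLike.edge_minorRadius.2, integral_w_edge hg, kappa0_eq_div]
  have hs : 0 < Real.sqrt d3alpha := Real.sqrt_pos.2 (by unfold d3alpha; norm_num)
  field_simp
  ring

/-- `V″` of the typed edge surface `=` `Vratio·Vp`. [cite: Jardin2010, §8.5 eq. (8.134)] -/
theorem lcEdgeData_V'' : (lcEdgeData g).V'' = Vratio * Vp := by
  unfold lcEdgeData Vp Vratio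
  rw [lcGGJData_V'' NstxLike.Ra_pos NstxLike.kappa0_pos hg (NstxLike.q0_pos hg) NstxLike.edge_minorRadius.1
    NstxLike.edge_minorRadius.2, integral_wDr_edge hg, lcAmp_eq hg.ne', kappa0_eq_div]
  have hs : 0 < Real.sqrt d3alpha := Real.sqrt_pos.2 (by unfold d3alpha; norm_num)
  have hR := NstxLike.Ra_pos
  have hK := K1_pos
  unfold ar NstxLike.ε
  field_simp
  ring

omit hg in
/-- `Ψ′ = 2π`. [cite: Jardin2010, §5.3 eq. (5.32)] -/
theorem lcEdgeData_Ψ' : (lcEdgeData g).Ψ' = 2 * π := rfl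

/-- `Φ′` of the typed edge surface `= g·K₄/(4√(|d₃|α))` (`= 2πq`). [cite: Jardin2010, §5.3 eq. (5.31)] -/
theorem lcEdgeData_Φ' : (lcEdgeData g).Φ' = g * K4 / (4 * Real.sqrt d3alpha) := by
  unfold lcEdgeData
  rw [lcGGJData_Φ' NstxLike.Ra_pos NstxLike.kappa0_pos hg (NstxLike.q0_pos hg) NstxLike.edge_minorRadius.1
    NstxLike.edge_minorRadius.2, integral_qKernel_edge, NstxLike.q0_eq g hg.le, sqrt_q0Sq_eq]
  have hs : 0 < Real.sqrt d3alpha := Real.sqrt_pos.2 (by unfold d3alpha; norm_num)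
  have hR := NstxLike.Ra_pos
  have hπ := Real.pi_pos
  field_simp
  ring

/-- `Φ″` of the typed edge surface `= g·phihat·Vp`. [cite: Jardin2010, §8.5 eq. (8.134)] -/
theorem lcEdgeData_Φ'' : (lcEdgeData g).Φ'' = g * phihat * Vp := by
  unfold lcEdgeData phihat Vp
  rw [lcGGJData_Φ'' NstxLike.Ra_pos NstxLike.kappa0_pos hg (NstxLike.q0_pos hg) NstxLike.edge_minorRadius.1
    NstxLike.edge_minorRadius.2, integral_qKernelDr_edge, lcAmp_eq hg.ne', NstxLike.q0_eq g hg.le, sqrt_q0Sq_eq]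
  have hs : 0 < Real.sqrt d3alpha := Real.sqrt_pos.2 (by unfold d3alpha; norm_num)
  have hR := NstxLike.Ra_pos
  have hπ := Real.pi_pos
  have hK := K1_pos
  unfold ar NstxLike.ε
  field_simp
  ring

/-- `p′ = −1` (`C_s = 1`). [cite: PatakiCerfonFreidberg2013, §6.1] -/
theorem lcEdgeData_p' : (lcEdgeData g).p' = -1 := by
  show -csLC NstxLike.kappa0 g NstxLike.Ra (NstxLike.q0 g) = -1
  rw [csLC_edge hg]

/-- `I′ = dI/dΨ = Vp/(2π)` (surface-averaged force balance, `C_s = 1`). [cite: Jardin2010, §5.3 eq. (5.34)] -/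
theorem lcEdgeData_I' : (lcEdgeData g).I' = Vp / (2 * π) := by
  unfold lcEdgeData Vp
  rw [lcGGJData_I' NstxLike.Ra_pos NstxLike.kappa0_pos hg (NstxLike.q0_pos hg) NstxLike.edge_minorRadius.1
    NstxLike.edge_minorRadius.2, integral_w_edge hg, csLC_edge hg, kappa0_eq_div]
  have hs : 0 < Real.sqrt d3alpha := Real.sqrt_pos.2 (by unfold d3alpha; norm_num)
  have hπ := Real.pi_pos
  field_simp
  ring

/-- `⟨B²/|∇Ψ|²⟩` of the typed edge surface `= B2G g = g²A7 + A4`. [cite: Jardin2010, §8.5 eq. (8.134)] -/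
theorem lcEdgeData_gB2 : (lcEdgeData g).gB2 = B2G g := by
  unfold lcEdgeData B2G A7 A4
  rw [lcGGJData_gB2 NstxLike.Ra_pos NstxLike.kappa0_pos hg (NstxLike.q0_pos hg) NstxLike.edge_minorRadius.1
    NstxLike.edge_minorRadius.2, integral_w_edge hg]
  have hsplit : ∀ t, (g ^ 2 + lcGradSq NstxLike.kappa0 g NstxLike.Ra (NstxLike.q0 g) (NstxLike.ε / NstxLike.Ra) t)
        / (lcU NstxLike.Ra (NstxLike.ε / NstxLike.Ra) t
            * lcGradSq NstxLike.kappa0 g NstxLike.Ra (NstxLike.q0 g) (NstxLike.ε / NstxLike.Ra) t)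
        * lcAvgWeight NstxLike.kappa0 g NstxLike.Ra (NstxLike.q0 g) (NstxLike.ε / NstxLike.Ra) t
      = g ^ 2 * (lcAvgWeight NstxLike.kappa0 g NstxLike.Ra (NstxLike.q0 g) (NstxLike.ε / NstxLike.Ra) t
          / (lcU NstxLike.Ra (NstxLike.ε / NstxLike.Ra) t
              * lcGradSq NstxLike.kappa0 g NstxLike.Ra (NstxLike.q0 g) (NstxLike.ε / NstxLike.Ra) t))
        + lcAvgWeight NstxLike.kappa0 g NstxLike.Ra (NstxLike.q0 g) (NstxLike.ε / NstxLike.Ra) t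
          / lcU NstxLike.Ra (NstxLike.ε / NstxLike.Ra) t := by
    intro t
    have hu := (lcU_edge_pos t).ne'
    have hG := (lcGradSq_edge_pos hg t).ne'
    field_simp
  simp_rw [hsplit]
  rw [intervalIntegral.integral_add (((continuous_w_div_uG_edge hg).const_mul _).intervalIntegrable _ _)
    ((continuous_w_div_u_edge hg).intervalIntegrable _ _), intervalIntegral.integral_const_mul,
    integral_w_div_uG_edge hg, integral_w_div_u_edge hg]
  have hk := NstxLike.kappa0_pos
  have hK := K1_pos
  have hc4 := c4_pos
  field_simp

/-- `⟨σB²/|∇Ψ|²⟩` of the typed edge surface `= g·A6`. [cite: Jardin2010, §8.5 eq. (8.134)] -/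
theorem lcEdgeData_gσB2 : (lcEdgeData g).gσB2 = g * A6 := by
  unfold lcEdgeData A6
  rw [lcGGJData_gσB2 NstxLike.Ra_pos NstxLike.kappa0_pos hg (NstxLike.q0_pos hg) NstxLike.edge_minorRadius.1
    NstxLike.edge_minorRadius.2, integral_w_edge hg, integral_w_div_G_edge hg, csLC_edge hg]
  have hk := NstxLike.kappa0_pos
  have hK := K1_pos
  have hc4 := c4_pos
  field_simp

/-- `⟨σ²B²/|∇Ψ|²⟩` of the typed edge surface `= Xavg g = KX(g)/K₁`. [cite: Jardin2010, §8.5 eq. (8.134)] -/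
theorem lcEdgeData_gσ2B2 : (lcEdgeData g).gσ2B2 = Xavg g := by
  unfold lcEdgeData Xavg
  rw [lcGGJData_gσ2B2 NstxLike.Ra_pos NstxLike.kappa0_pos hg (NstxLike.q0_pos hg) NstxLike.edge_minorRadius.1
    NstxLike.edge_minorRadius.2, integral_w_edge hg, integral_invBsqGradSq_edge hg, csLC_edge hg]
  have hk := NstxLike.kappa0_pos
  have hK := K1_pos
  field_simp

/-- `⟨1/B²⟩` of the typed edge surface `= Yavg g = KY(g)/K₁`. [cite: Jardin2010, §8.5 eq. (8.134)] -/
theorem lcEdgeData_invB2 : (lcEdgeData g).invB2 = Yavg g := by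
  unfold lcEdgeData Yavg
  rw [lcGGJData_invB2 NstxLike.Ra_pos NstxLike.kappa0_pos hg (NstxLike.q0_pos hg) NstxLike.edge_minorRadius.1
    NstxLike.edge_minorRadius.2, integral_w_edge hg, integral_invBsq_edge hg]
  have hk := NstxLike.kappa0_pos
  have hK := K1_pos
  field_simp

/-- **THE KERNEL BRIDGE (record level):** the GGJ input record of the typed equilibrium's edge surface — every field a
functional of `Literature/…/FluxSurfaceAverage` evaluated on `Ψ` and the printed loop — EQUALS the certificate's
`edgeData g (Vp/(2π))` of `…MercierEdgeGGJ` §7 (p482628 §7), all thirteen fields. [cite: Jardin2010, §8.5 eq. (8.134)] -/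
theorem lcEdgeData_eq_edgeData : lcEdgeData g = edgeData g (Vp / (2 * π)) := by
  have h1 := lcEdgeData_V' hg
  have h2 := lcEdgeData_V'' hg
  have h5 := lcEdgeData_Φ' hg
  have h6 := lcEdgeData_Φ'' hg
  have h7 := lcEdgeData_I' hg
  have h9 := lcEdgeData_p' hg
  have h10 := lcEdgeData_gB2 hg
  have h11 := lcEdgeData_gσB2 hg
  have h12 := lcEdgeData_gσ2B2 hg
  have h13 := lcEdgeData_invB2 hg
  unfold lcEdgeData lcGGJData at *
  unfold edgeData
  simp only [Literature.MathematicalPhysics.MHD.Mercier.FluxForm.SurfaceData.mk.injEq]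
  refine ⟨h1, h2, ?_, ?_, h5, h6, h7, ?_, h9, h10, h11, h12, h13⟩ <;> trivial

/-- Jardin's `F` (8.134) of the typed edge surface `=` the certificate's `mercierF g`. [cite: Jardin2010, §8.5 eq. (8.134)] -/
theorem mercierF_lcEdgeData : (lcEdgeData g).mercierF = mercierF g := by
  rw [lcEdgeData_eq_edgeData hg, mercierF_edgeData]

end fields

/-! ## §6 The certified Mercier statement on the typed equilibrium, end to end -/

/-- **F1 / MERCIER-profile at the EDGE, END TO END IN THE KERNEL (NSTX-like PCF Solov'ev, F-parametric):** for every value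
`g = F = RB_φ ≥ 1/4` of the free constant, the flux-coordinate Mercier criterion — Jardin (8.134) `F > 0` as typed by
`Mercier.FluxForm.SurfaceData.MercierCriterion` — holds for the record of the tree's OWN functionals (`volumeDerivE`,
`toroidalFluxDerivJ`, `toroidalCurrentJ`, `surfaceAverageE`) of the typed equilibrium `Ψ = psiLC κ₀ g R_a q₀(g) (ε/R_a)`
(`= NstxLike.psi`) on the printed edge loop. Chain: `lcGGJData` field lemmas (model-5, p481986) → §1 substitution →
kernel enclosures `K₁…K₈`, `KX ≤ K₈/(4αρ²)`, `KY ≤ K₅/g²` (p480149/p480967/p482340) → `mercierF_pos_of_le` (p482628).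
MODELLED: ideal MHD, analytic fixed-boundary Solov'ev equilibrium; Mercier is NECESSARY for interchange stability; nothing
here says a plasma or device is stable. [cite: Jardin2010, §8.5 eq. (8.134)] -/
theorem mercierCriterion_lcEdgeData_of_le {g : ℝ} (hg : (1 / 4 : ℝ) ≤ g) : (lcEdgeData g).MercierCriterion := by
  have hg0 : 0 < g := lt_of_lt_of_le (by norm_num) hg
  rw [lcEdgeData_eq_edgeData hg0]
  exact mercierCriterion_edge_of_le hg _

/-- The same record written with the typed flux function `NstxLike.psi` itself (`psi_eq_psiLC`): e.g. its `V′` is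
`volumeDerivE NstxLike.psi (lcLoop R_a κ₀ (ε/R_a)) (2π) = Vp`. [cite: Freidberg2014, §6.3.2 eq. (6.22)] -/
theorem volumeDerivE_psi_edge {g : ℝ} (hg : 0 < g) :
    GradShafranov.volumeDerivE NstxLike.psi (lcLoop NstxLike.Ra NstxLike.kappa0 (NstxLike.ε / NstxLike.Ra)) (2 * π)
      = Vp := by
  rw [NstxLike.psi_eq_psiLC hg.ne']
  exact lcEdgeData_V' hg

/-- **Label independence in the kernel:** the criterion holds for EVERY admissible relabelling `ψ ↦ h(ψ)` (`h′ ≠ 0`) of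
the edge record (force balance `p′V′ + I′Ψ′ − K′Φ′ = 0` on the family is model-5's `lcGGJData_isForceBalanced`, p485756;
covariance is lit-3's `mercierCriterion_relabel_iff`, p479625). [cite: Jardin2010, §8.5 eq. (8.134)] -/
theorem mercierCriterion_lcEdgeData_relabel_of_le {g : ℝ} (hg : (1 / 4 : ℝ) ≤ g) (h1 h2 : ℝ) (hh : h1 ≠ 0) :
    ((lcEdgeData g).relabel h1 h2).MercierCriterion := by
  have hg0 : 0 < g := lt_of_lt_of_le (by norm_num) hg
  exact (mercierCriterion_lcGGJData_relabel_iff NstxLike.Ra_pos NstxLike.kappa0_pos hg0 (NstxLike.q0_pos hg0)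
    NstxLike.edge_minorRadius.1 NstxLike.edge_minorRadius.2 _ g h1 h2 hh).2 (mercierCriterion_lcEdgeData_of_le hg)

/-- **Axis AND edge on the typed objects, one threshold:** for every `F ≥ F_M⁺ = 1.11855148457759885406` both the
near-axis Mercier criterion (Bateman (7.3.2); `…MercierAxis`, p472230) and the flux-coordinate Mercier criterion of the
typed edge surface hold. [cite: Jardin2010, §8.5 eq. (8.134)] -/
theorem mercierAxis_and_lcEdge_of_le {F : ℝ} (hF : SolovevPCFNstx.MercierAxis.FmercHi ≤ F) :
    Literature.MathematicalPhysics.MHD.Mercier.NearAxis.MercierCriterion (SolovevPCFNstx.MercierAxis.q0 F) SolovevPCFNstx.MercierAxis.elong 0 0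
      ∧ (lcEdgeData F).MercierCriterion := by
  have h35 : (1 / 4 : ℝ) ≤ F := le_trans (by unfold SolovevPCFNstx.MercierAxis.FmercHi; norm_num) hF
  exact ⟨SolovevPCFNstx.MercierAxis.mercier_elong_of_le hF, mercierCriterion_lcEdgeData_of_le h35⟩

end Summit.Ventures.FusionMHD.Bench.SolovevPCFNstx.MercierEdge

end
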